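import Summits.AnomalousDissipation.AnomalousDissipation.Theses.StirringSphere
import Literature.Analysis.FluidPDE.StatisticalSolutionDirac
import Literature.Analysis.FluidPDE.StatisticalSolutionProofs

/-!
# Negative knowledge for the crux `StirringSphere.NoScreening` (stmt-AnomalousDissipation-17144), part 1/2:
# the stirring family under the half-lattice shift, and two-point mixtures of Dirac statistics

Strategist seat `planner-cstrat-stmt-AnomalousDissipation-17144-r1-0` (2026-08-17, second-opinion census).
Ingredients of the certified reduction `NoScreening ⟹ ν-uniform universal injection floor for the steady states of
the single force ±b₂` (part 2/2, `SteadyPolarFloor.lean`):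

* §A — for the route's explicit triple `b = (b₀, b₁, b₂)` (the literal `![…]` pinned by the binder `b = ![…]` of every
  item of route StirringSphere; no new definition is introduced, every lemma takes `(b) (hb : b = ![…])`) and the
  half-lattice shift `h = (½,½,½)` (likewise a bound variable with `hh : h = fun _ => ↑2⁻¹`): the PARITIES
  `b₀(x + h) = −b₀(x)`, `b₁(x + h) = −b₁(x)`, `b₂(x + h) = b₂(x)` (`stir_parity`: shell `|k|² = 1` is odd, shell
  `|k|² = 2` even under `τ_h`), `h + h = 0`, the pole dictionary `Σᵢ (s e₂)ᵢ bᵢ = s b₂`, smoothness of the `bᵢ`;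
* §D — the midpoint `½(δ_u + δ_v)` of two Foias–Prodi Dirac statistics is a Foias–Prodi statistics
  (`isStationaryStatisticalSolution_halfDiracPair`; every clause of FMRT IV Def. 1.3 is affine in the measure and
  Dirac components need no integrability side condition), with its integral bookkeeping.

Parity computations follow `Cruxes/HairyBallAlignment/Lines/pole.lean` (planner-cstrat-…-17155-b1).  Sorry-free.

## References
* C. Foias, O. Manley, R. Rosa, R. Temam, *Navier–Stokes Equations and Turbulence* (CUP 2001), Ch. IV §1.2
  Def. 1.3 and the remark pp. 181–182 (Dirac masses at steady states). [FMRTTurbulence2001]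
-/

noncomputable section

set_option linter.dupNamespace false

namespace Summit.AnomalousDissipation.AnomalousDissipation.Theorems.NoScreening.Negative

open MeasureTheory Filter
open scoped InnerProductSpace RealInnerProductSpace ENNReal NNReal BigOperators
open Literature.Analysis.FunctionSpaces Literature.Analysis.FluidPDE
open Summit.AnomalousDissipation.AnomalousDissipation.Theses.StirringSphere

/-! ## §A  The stirring family and the half-lattice shift -/

/-- `h + h = 0` for the half-lattice shift `h = (½, ½, ½) ∈ T³ = (ℝ/ℤ)³`. -/
theorem halfShift_add_halfShift (h : UnitAddTorus (Fin 3)) (hh : h = fun _ => ((2⁻¹ : ℝ) : UnitAddCircle)) :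
    h + h = 0 := by
  subst hh
  funext i
  show ((2⁻¹ : ℝ) : UnitAddCircle) + ((2⁻¹ : ℝ) : UnitAddCircle) = 0
  rw [← AddCircle.coe_add, show (2⁻¹ : ℝ) + 2⁻¹ = 1 by norm_num]
  exact AddCircle.coe_period (1 : ℝ)

/-- `−h = h` for the half-lattice shift. -/
theorem neg_halfShift (h : UnitAddTorus (Fin 3)) (hh : h = fun _ => ((2⁻¹ : ℝ) : UnitAddCircle)) : -h = h :=
  neg_eq_of_add_eq_zero_right (halfShift_add_halfShift h hh)

/-- `x − h = x + h` for the half-lattice shift. -/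
theorem sub_halfShift (h : UnitAddTorus (Fin 3)) (hh : h = fun _ => ((2⁻¹ : ℝ) : UnitAddCircle))
    (x : UnitAddTorus (Fin 3)) : x - h = x + h := by
  rw [sub_eq_add_neg, neg_halfShift h hh]

/-- `e^{2πi(x+½)} = −e^{2πix}` on `ℝ/ℤ` (Mathlib `fourier_add_half_inv_index` with `T = 1`, `n = 1`). -/
theorem fourier_one_add_half (x : UnitAddCircle) :
    @fourier 1 1 (x + ((2⁻¹ : ℝ) : UnitAddCircle)) = - fourier 1 x := by
  have h := @fourier_add_half_inv_index 1 1 one_ne_zero one_pos x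
  simpa using h

/-- Shell-one monomials are ODD under the half-lattice shift: `e_k(x + h) = −e_k(x)` for `k = eᵢ`. -/
theorem mFourier_single_add_halfShift (h : UnitAddTorus (Fin 3)) (hh : h = fun _ => ((2⁻¹ : ℝ) : UnitAddCircle))
    (x : UnitAddTorus (Fin 3)) (i : Fin 3) :
    UnitAddTorus.mFourier (Pi.single i (1 : ℤ)) (x + h) = - UnitAddTorus.mFourier (Pi.single i (1 : ℤ)) x := by
  subst hh
  rw [UnitAddTorus.mFourier_single, UnitAddTorus.mFourier_single]
  simp only [Pi.add_apply]
  exact fourier_one_add_half (x i)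

/-- Shell-two monomials are EVEN under the half-lattice shift: `e_k(x + h) = e_k(x)` for `k = eᵢ + eⱼ`. -/
theorem mFourier_pair_add_halfShift (h : UnitAddTorus (Fin 3)) (hh : h = fun _ => ((2⁻¹ : ℝ) : UnitAddCircle))
    (x : UnitAddTorus (Fin 3)) (i j : Fin 3) :
    UnitAddTorus.mFourier (Pi.single i (1 : ℤ) + Pi.single j 1) (x + h) =
      UnitAddTorus.mFourier (Pi.single i (1 : ℤ) + Pi.single j 1) x := by
  rw [UnitAddTorus.mFourier_add, UnitAddTorus.mFourier_add, mFourier_single_add_halfShift h hh,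
    mFourier_single_add_halfShift h hh, neg_mul_neg]

/-- `(0,1,1) = e₁ + e₂` in `ℤ³`. -/
theorem k011 : (![(0 : ℤ), 1, 1] : Fin 3 → ℤ) = Pi.single 1 1 + Pi.single 2 1 := by
  ext i; fin_cases i <;> simp

/-- `(1,0,1) = e₀ + e₂` in `ℤ³`. -/
theorem k101 : (![(1 : ℤ), 0, 1] : Fin 3 → ℤ) = Pi.single 0 1 + Pi.single 2 1 := by
  ext i; fin_cases i <;> simp

/-- `(1,1,0) = e₀ + e₁` in `ℤ³`. -/
theorem k110 : (![(1 : ℤ), 1, 0] : Fin 3 → ℤ) = Pi.single 0 1 + Pi.single 1 1 := by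
  ext i; fin_cases i <;> simp

/-- A shell-one Stokes mode is odd under the half-lattice shift. -/
theorem stokesMode_single_add_halfShift (h : UnitAddTorus (Fin 3)) (hh : h = fun _ => ((2⁻¹ : ℝ) : UnitAddCircle))
    (i : Fin 3) (a : EuclideanSpace ℝ (Fin 3)) (cb : Bool) (x : UnitAddTorus (Fin 3)) :
    Torus.stokesMode (Pi.single i (1 : ℤ)) a cb (x + h) = - Torus.stokesMode (Pi.single i (1 : ℤ)) a cb x := by
  rw [Torus.stokesMode_apply, Torus.stokesMode_apply, mFourier_single_add_halfShift h hh]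
  cases cb <;> simp [neg_smul]

/-- A shell-two Stokes mode with wave vector `eᵢ + eⱼ` is even under the half-lattice shift. -/
theorem stokesMode_pair_add_halfShift (h : UnitAddTorus (Fin 3)) (hh : h = fun _ => ((2⁻¹ : ℝ) : UnitAddCircle))
    (i j : Fin 3) (a : EuclideanSpace ℝ (Fin 3)) (cb : Bool) (x : UnitAddTorus (Fin 3)) :
    Torus.stokesMode (Pi.single i (1 : ℤ) + Pi.single j 1) a cb (x + h) =
      Torus.stokesMode (Pi.single i (1 : ℤ) + Pi.single j 1) a cb x := by
  rw [Torus.stokesMode_apply, Torus.stokesMode_apply, mFourier_pair_add_halfShift h hh]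

/-- **Parity of the stirring family under the half-lattice shift** (`τ_h` acts on `span(b₀, b₁, b₂)` by
`diag(−1, −1, +1)`): `b₀(x + h) = −b₀(x)`, `b₁(x + h) = −b₁(x)`, `b₂(x + h) = b₂(x)`. [folklore] -/
theorem stir_parity (b : Fin 3 → UnitAddTorus (Fin 3) → EuclideanSpace ℝ (Fin 3))
    (hb : b = ![(fun x : UnitAddTorus (Fin 3) => (Literature.Analysis.FluidPDE.Torus.stokesMode (Pi.single (2 : Fin 3) (1 : ℤ)) (EuclideanSpace.single (0 : Fin 3) (1 : ℝ)) false x + Literature.Analysis.FluidPDE.Torus.stokesMode (Pi.single (0 : Fin 3) (1 : ℤ)) (EuclideanSpace.single (1 : Fin 3) (1 : ℝ)) false x + Literature.Analysis.FluidPDE.Torus.stokesMode (Pi.single (1 : Fin 3) (1 : ℤ)) (EuclideanSpace.single (2 : Fin 3) (1 : ℝ)) false x : EuclideanSpace ℝ (Fin 3))), (fun x : UnitAddTorus (Fin 3) => (Literature.Analysis.FluidPDE.Torus.stokesMode (Pi.single (1 : Fin 3) (1 : ℤ)) (EuclideanSpace.single (0 : Fin 3) (1 : ℝ)) true x + Literature.Analysis.FluidPDE.Torus.stokesMode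 (Pi.single (2 : Fin 3) (1 : ℤ)) (EuclideanSpace.single (1 : Fin 3) (1 : ℝ)) true x + Literature.Analysis.FluidPDE.Torus.stokesMode (Pi.single (0 : Fin 3) (1 : ℤ)) (EuclideanSpace.single (2 : Fin 3) (1 : ℝ)) true x : EuclideanSpace ℝ (Fin 3))), (fun x : UnitAddTorus (Fin 3) => (Literature.Analysis.FluidPDE.Torus.stokesMode ![(0 : ℤ), 1, 1] (EuclideanSpace.single (0 : Fin 3) (1 : ℝ)) false x + Literature.Analysis.FluidPDE.Torus.stokesMode ![(1 : ℤ), 0, 1] (EuclideanSpace.single (1 : Fin 3) (1 : ℝ)) false x + Literature.Analysis.FluidPDE.Torus.stokesMode ![(1 : ℤ), 1, 0] (EuclideanSpace.single (2 : Fin 3) (1 : ℝ)) false x : EuclideanSpace ℝ (Fin 3)))])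
    (h : UnitAddTorus (Fin 3)) (hh : h = fun _ => ((2⁻¹ : ℝ) : UnitAddCircle)) (x : UnitAddTorus (Fin 3)) :
    b 0 (x + h) = - b 0 x ∧ b 1 (x + h) = - b 1 x ∧ b 2 (x + h) = b 2 x := by
  subst hb
  refine ⟨?_, ?_, ?_⟩
  · show (Torus.stokesMode (Pi.single (2 : Fin 3) (1 : ℤ)) (EuclideanSpace.single (0 : Fin 3) (1 : ℝ)) false (x + h)
        + Torus.stokesMode (Pi.single (0 : Fin 3) (1 : ℤ)) (EuclideanSpace.single (1 : Fin 3) (1 : ℝ)) false (x + h)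
        + Torus.stokesMode (Pi.single (1 : Fin 3) (1 : ℤ)) (EuclideanSpace.single (2 : Fin 3) (1 : ℝ)) false (x + h) : EuclideanSpace ℝ (Fin 3))
      = -(Torus.stokesMode (Pi.single (2 : Fin 3) (1 : ℤ)) (EuclideanSpace.single (0 : Fin 3) (1 : ℝ)) false x
        + Torus.stokesMode (Pi.single (0 : Fin 3) (1 : ℤ)) (EuclideanSpace.single (1 : Fin 3) (1 : ℝ)) false x
        + Torus.stokesMode (Pi.single (1 : Fin 3) (1 : ℤ)) (EuclideanSpace.single (2 : Fin 3) (1 : ℝ)) false x)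
    rw [stokesMode_single_add_halfShift h hh, stokesMode_single_add_halfShift h hh, stokesMode_single_add_halfShift h hh]
    abel
  · show (Torus.stokesMode (Pi.single (1 : Fin 3) (1 : ℤ)) (EuclideanSpace.single (0 : Fin 3) (1 : ℝ)) true (x + h)
        + Torus.stokesMode (Pi.single (2 : Fin 3) (1 : ℤ)) (EuclideanSpace.single (1 : Fin 3) (1 : ℝ)) true (x + h)
        + Torus.stokesMode (Pi.single (0 : Fin 3) (1 : ℤ)) (EuclideanSpace.single (2 : Fin 3) (1 : ℝ)) true (x + h) : EuclideanSpace ℝ (Fin 3))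
      = -(Torus.stokesMode (Pi.single (1 : Fin 3) (1 : ℤ)) (EuclideanSpace.single (0 : Fin 3) (1 : ℝ)) true x
        + Torus.stokesMode (Pi.single (2 : Fin 3) (1 : ℤ)) (EuclideanSpace.single (1 : Fin 3) (1 : ℝ)) true x
        + Torus.stokesMode (Pi.single (0 : Fin 3) (1 : ℤ)) (EuclideanSpace.single (2 : Fin 3) (1 : ℝ)) true x)
    rw [stokesMode_single_add_halfShift h hh, stokesMode_single_add_halfShift h hh, stokesMode_single_add_halfShift h hh]
    abel
  · show (Torus.stokesMode ![(0 : ℤ), 1, 1] (EuclideanSpace.single (0 : Fin 3) (1 : ℝ)) false (x + h)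
        + Torus.stokesMode ![(1 : ℤ), 0, 1] (EuclideanSpace.single (1 : Fin 3) (1 : ℝ)) false (x + h)
        + Torus.stokesMode ![(1 : ℤ), 1, 0] (EuclideanSpace.single (2 : Fin 3) (1 : ℝ)) false (x + h) : EuclideanSpace ℝ (Fin 3))
      = Torus.stokesMode ![(0 : ℤ), 1, 1] (EuclideanSpace.single (0 : Fin 3) (1 : ℝ)) false x
        + Torus.stokesMode ![(1 : ℤ), 0, 1] (EuclideanSpace.single (1 : Fin 3) (1 : ℝ)) false x
        + Torus.stokesMode ![(1 : ℤ), 1, 0] (EuclideanSpace.single (2 : Fin 3) (1 : ℝ)) false x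
    rw [k011, k101, k110, stokesMode_pair_add_halfShift h hh, stokesMode_pair_add_halfShift h hh,
      stokesMode_pair_add_halfShift h hh]

/-- Every member of the stirring family is smooth (finite sums of Stokes modes). -/
theorem isSmooth_stir (b : Fin 3 → UnitAddTorus (Fin 3) → EuclideanSpace ℝ (Fin 3))
    (hb : b = ![(fun x : UnitAddTorus (Fin 3) => (Literature.Analysis.FluidPDE.Torus.stokesMode (Pi.single (2 : Fin 3) (1 : ℤ)) (EuclideanSpace.single (0 : Fin 3) (1 : ℝ)) false x + Literature.Analysis.FluidPDE.Torus.stokesMode (Pi.single (0 : Fin 3) (1 : ℤ)) (EuclideanSpace.single (1 : Fin 3) (1 : ℝ)) false x + Literature.Analysis.FluidPDE.Torus.stokesMode (Pi.single (1 : Fin 3) (1 : ℤ)) (EuclideanSpace.single (2 : Fin 3) (1 : ℝ)) false x : EuclideanSpace ℝ (Fin 3))), (fun x : UnitAddTorus (Fin 3) => (Literature.Analysis.FluidPDE.Torus.stokesMode (Pi.single (1 : Fin 3) (1 : ℤ)) (EuclideanSpace.single (0 : Fin 3) (1 : ℝ)) true x + Literature.Analysis.FluidPDE.Torus.stokesMode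 (Pi.single (2 : Fin 3) (1 : ℤ)) (EuclideanSpace.single (1 : Fin 3) (1 : ℝ)) true x + Literature.Analysis.FluidPDE.Torus.stokesMode (Pi.single (0 : Fin 3) (1 : ℤ)) (EuclideanSpace.single (2 : Fin 3) (1 : ℝ)) true x : EuclideanSpace ℝ (Fin 3))), (fun x : UnitAddTorus (Fin 3) => (Literature.Analysis.FluidPDE.Torus.stokesMode ![(0 : ℤ), 1, 1] (EuclideanSpace.single (0 : Fin 3) (1 : ℝ)) false x + Literature.Analysis.FluidPDE.Torus.stokesMode ![(1 : ℤ), 0, 1] (EuclideanSpace.single (1 : Fin 3) (1 : ℝ)) false x + Literature.Analysis.FluidPDE.Torus.stokesMode ![(1 : ℤ), 1, 0] (EuclideanSpace.single (2 : Fin 3) (1 : ℝ)) false x : EuclideanSpace ℝ (Fin 3)))])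
    (i : Fin 3) : Torus.IsSmooth (b i) := by
  subst hb
  fin_cases i
  all_goals
    exact ((Torus.isSmooth_stokesMode _ _ _).add (Torus.isSmooth_stokesMode _ _ _)).add (Torus.isSmooth_stokesMode _ _ _)

/-- Every member of the stirring family is continuous. -/
theorem continuous_stir (b : Fin 3 → UnitAddTorus (Fin 3) → EuclideanSpace ℝ (Fin 3))
    (hb : b = ![(fun x : UnitAddTorus (Fin 3) => (Literature.Analysis.FluidPDE.Torus.stokesMode (Pi.single (2 : Fin 3) (1 : ℤ)) (EuclideanSpace.single (0 : Fin 3) (1 : ℝ)) false x + Literature.Analysis.FluidPDE.Torus.stokesMode (Pi.single (0 : Fin 3) (1 : ℤ)) (EuclideanSpace.single (1 : Fin 3) (1 : ℝ)) false x + Literature.Analysis.FluidPDE.Torus.stokesMode (Pi.single (1 : Fin 3) (1 : ℤ)) (EuclideanSpace.single (2 : Fin 3) (1 : ℝ)) false x : EuclideanSpace ℝ (Fin 3))), (fun x : UnitAddTorus (Fin 3) => (Literature.Analysis.FluidPDE.Torus.stokesMode (Pi.single (1 : Fin 3) (1 : ℤ)) (EuclideanSpace.single (0 : Fin 3) (1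 : ℝ)) true x + Literature.Analysis.FluidPDE.Torus.stokesMode (Pi.single (2 : Fin 3) (1 : ℤ)) (EuclideanSpace.single (1 : Fin 3) (1 : ℝ)) true x + Literature.Analysis.FluidPDE.Torus.stokesMode (Pi.single (0 : Fin 3) (1 : ℤ)) (EuclideanSpace.single (2 : Fin 3) (1 : ℝ)) true x : EuclideanSpace ℝ (Fin 3))), (fun x : UnitAddTorus (Fin 3) => (Literature.Analysis.FluidPDE.Torus.stokesMode ![(0 : ℤ), 1, 1] (EuclideanSpace.single (0 : Fin 3) (1 : ℝ)) false x + Literature.Analysis.FluidPDE.Torus.stokesMode ![(1 : ℤ), 0, 1] (EuclideanSpace.single (1 : Fin 3) (1 : ℝ)) false x + Literature.Analysis.FluidPDE.Torus.stokesMode ![(1 : ℤ), 1, 0] (EuclideanSpace.single (2 : Fin 3) (1 : ℝ)) false x : EuclideanSpace ℝ (Fin 3)))])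
    (i : Fin 3) : Continuous (b i) :=
  (isSmooth_stir b hb i).continuous

/-- THE POLE DICTIONARY: the force of the stirring sphere at `c = s • e₂` is `s • b₂`. -/
theorem force_pole (b : Fin 3 → UnitAddTorus (Fin 3) → EuclideanSpace ℝ (Fin 3)) (s : ℝ) :
    (fun x : UnitAddTorus (Fin 3) => ∑ i : Fin 3, (EuclideanSpace.single (2 : Fin 3) s) i • b i x) =
      fun x => s • b 2 x := by
  funext x
  simp

/-- `‖s • e₂‖ = 1` for a sign `s = ±1`. -/
theorem norm_pole {s : ℝ} (hs : s = 1 ∨ s = -1) : ‖EuclideanSpace.single (2 : Fin 3) s‖ = 1 := by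
  rcases hs with rfl | rfl <;> simp

/-- The `L²` pairing is odd in the field: `(u, −g) = −(u, g)` (no integrability needed). -/
theorem pairing_neg (u : Lp (EuclideanSpace ℝ (Fin 3)) 2 (volume : Measure (UnitAddTorus (Fin 3))))
    (g : UnitAddTorus (Fin 3) → EuclideanSpace ℝ (Fin 3)) :
    Torus.pairing u (-g) = - Torus.pairing u g := by
  unfold Torus.pairing
  simp [inner_neg_right, integral_neg]

/-- The `L²` pairing is odd in the field (lambda form): `(u, x ↦ −g x) = −(u, g)`. -/
theorem pairing_fun_neg (u : Lp (EuclideanSpace ℝ (Fin 3)) 2 (volume : Measure (UnitAddTorus (Fin 3))))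
    (g : UnitAddTorus (Fin 3) → EuclideanSpace ℝ (Fin 3)) :
    Torus.pairing u (fun x => - g x) = - Torus.pairing u g :=
  pairing_neg u g

/-- The `L²` pairing is homogeneous in the field: `(u, s • g) = s (u, g)` (no integrability needed). -/
theorem pairing_const_smul (u : Lp (EuclideanSpace ℝ (Fin 3)) 2 (volume : Measure (UnitAddTorus (Fin 3))))
    (s : ℝ) (g : UnitAddTorus (Fin 3) → EuclideanSpace ℝ (Fin 3)) :
    Torus.pairing u (fun x => s • g x) = s * Torus.pairing u g := by
  unfold Torus.pairing
  simp [inner_smul_right, integral_const_mul]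

/-! ## §D  Two-point mixtures of Dirac masses `½(δ_u + δ_v)` -/

section Mixture

/-- `½ ≠ ∞` in `ℝ≥0∞`. -/
theorem inv_two_ne_top : (2⁻¹ : ℝ≥0∞) ≠ ⊤ := by simp

/-- Every real observable is integrable against `½(δ_u + δ_v)`. -/
theorem integrable_halfDiracPair (g : Torus.energySpace (Fin 3) → ℝ) (u v : Torus.energySpace (Fin 3)) :
    Integrable g ((2⁻¹ : ℝ≥0∞) • Measure.dirac u + (2⁻¹ : ℝ≥0∞) • Measure.dirac v) :=
  ((Torus.integrable_dirac u g).smul_measure inv_two_ne_top).add_measure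
    ((Torus.integrable_dirac v g).smul_measure inv_two_ne_top)

/-- `∫ g d(½(δ_u + δ_v)) = ½ g(u) + ½ g(v)`. -/
theorem integral_halfDiracPair (g : Torus.energySpace (Fin 3) → ℝ) (u v : Torus.energySpace (Fin 3)) :
    ∫ w, g w ∂((2⁻¹ : ℝ≥0∞) • Measure.dirac u + (2⁻¹ : ℝ≥0∞) • Measure.dirac v) = 2⁻¹ * g u + 2⁻¹ * g v := by
  haveI : MeasurableSingletonClass (Torus.energySpace (Fin 3)) := OpensMeasurableSpace.toMeasurableSingletonClass
  rw [integral_add_measure ((Torus.integrable_dirac u g).smul_measure inv_two_ne_top)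
      ((Torus.integrable_dirac v g).smul_measure inv_two_ne_top),
    integral_smul_measure, integral_smul_measure, integral_dirac, integral_dirac]
  simp only [smul_eq_mul, ENNReal.toReal_inv, ENNReal.toReal_ofNat]

/-- Shell integrals: `∫_A g d(½(δ_u + δ_v)) = ½ ∫_A g dδ_u + ½ ∫_A g dδ_v`. -/
theorem setIntegral_halfDiracPair (g : Torus.energySpace (Fin 3) → ℝ) (u v : Torus.energySpace (Fin 3))
    (A : Set (Torus.energySpace (Fin 3))) :
    ∫ w in A, g w ∂((2⁻¹ : ℝ≥0∞) • Measure.dirac u + (2⁻¹ : ℝ≥0∞) • Measure.dirac v) =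
      2⁻¹ * (∫ w in A, g w ∂(Measure.dirac u)) + 2⁻¹ * (∫ w in A, g w ∂(Measure.dirac v)) := by
  rw [Measure.restrict_add, Measure.restrict_smul, Measure.restrict_smul,
    integral_add_measure (((Torus.integrable_dirac u g).mono_measure Measure.restrict_le_self).smul_measure inv_two_ne_top)
      (((Torus.integrable_dirac v g).mono_measure Measure.restrict_le_self).smul_measure inv_two_ne_top),
    integral_smul_measure, integral_smul_measure]
  simp only [smul_eq_mul, ENNReal.toReal_inv, ENNReal.toReal_ofNat]

/-- Lower integrals: `∫⁻ G d(½(δ_u + δ_v)) = ½ ∫⁻ G dδ_u + ½ ∫⁻ G dδ_v`. -/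
theorem lintegral_halfDiracPair (G : Torus.energySpace (Fin 3) → ℝ≥0∞) (u v : Torus.energySpace (Fin 3)) :
    ∫⁻ w, G w ∂((2⁻¹ : ℝ≥0∞) • Measure.dirac u + (2⁻¹ : ℝ≥0∞) • Measure.dirac v) =
      2⁻¹ * (∫⁻ w, G w ∂(Measure.dirac u)) + 2⁻¹ * (∫⁻ w, G w ∂(Measure.dirac v)) := by
  simp only [lintegral_add_measure, lintegral_smul_measure, smul_eq_mul]

/-- `½(δ_u + δ_v)` is a probability measure. -/
theorem isProbabilityMeasure_halfDiracPair (u v : Torus.energySpace (Fin 3)) :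
    IsProbabilityMeasure ((2⁻¹ : ℝ≥0∞) • Measure.dirac u + (2⁻¹ : ℝ≥0∞) • Measure.dirac v) := by
  refine ⟨?_⟩
  rw [Measure.add_apply, Measure.smul_apply, Measure.smul_apply, measure_univ, measure_univ, smul_eq_mul,
    mul_one, ENNReal.inv_two_add_inv_two]

/-- **Two-point mixtures of Foias–Prodi Dirac statistics are Foias–Prodi statistics** (every clause of
FMRT IV Def. 1.3 is affine in the measure; with Dirac components no integrability side condition arises).
[cite: FMRTTurbulence2001, Ch. IV §1.2 Def. 1.3] -/
theorem isStationaryStatisticalSolution_halfDiracPair {ν : ℝ} {f : UnitAddTorus (Fin 3) → EuclideanSpace ℝ (Fin 3)}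
    {u v : Torus.energySpace (Fin 3)} (hu : Torus.IsStationaryStatisticalSolution ν f (Measure.dirac u))
    (hv : Torus.IsStationaryStatisticalSolution ν f (Measure.dirac v)) :
    Torus.IsStationaryStatisticalSolution ν f ((2⁻¹ : ℝ≥0∞) • Measure.dirac u + (2⁻¹ : ℝ≥0∞) • Measure.dirac v) := by
  refine ⟨isProbabilityMeasure_halfDiracPair u v, ?_, ?_, ?_⟩
  · rw [lintegral_halfDiracPair]
    exact ENNReal.add_lt_top.2 ⟨ENNReal.mul_lt_top (by simp) hu.enstrophy_finite,
      ENNReal.mul_lt_top (by simp) hv.enstrophy_finite⟩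
  · intro Φ
    refine ⟨integrable_halfDiracPair _ u v, ?_⟩
    rw [integral_halfDiracPair (fun w => Torus.nsGeneratorPairing ν f w (Φ.grad w)) u v]
    have hu0 := (hu.generator Φ).2
    have hv0 := (hv.generator Φ).2
    haveI : MeasurableSingletonClass (Torus.energySpace (Fin 3)) := OpensMeasurableSpace.toMeasurableSingletonClass
    rw [integral_dirac] at hu0 hv0
    rw [hu0, hv0]
    norm_num
  · intro e₁ e₂ he
    rw [setIntegral_halfDiracPair]
    have hu' := hu.energy_ineq e₁ e₂ he
    have hv' := hv.energy_ineq e₁ e₂ he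
    nlinarith

end Mixture

end Summit.AnomalousDissipation.AnomalousDissipation.Theorems.NoScreening.Negative

end
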